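import Summits.BirchSwinnertonDyer.BirchSwinnertonDyer.Theorems.SchneiderFreeAdditiveX3PoitouTateSelmerDualityHolds
import Summits.BirchSwinnertonDyer.BirchSwinnertonDyer.Theorems.SchneiderFreeAdditiveX3PoitouTateReciprocityCanonical
import HarnessLib

/-!
# The SIGN-FREE E-side reciprocity sum HOLDS for every number field; `poitouTate_selmerStructure_duality_real K` and
# `(LocalInvariants.canonical K n).SelmerComplement` for every `K`, `n`

Cell `bsd-schneider`, seat `door-c4` g18.  Crux `stmt-BirchSwinnertonDyer-19295` `AnticycControlAdditiveK`.  Theorems only; no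
definition, no named fact, no instance, no `sorry`.

`SchneiderFreeAdditiveX3PoitouTateSelmerDualityHolds.idelePackage_holds` (door-c4 g18) gives, for every `(f, ŷ, T₀)`, the E-side idèle
package (P0)–(P4); the sum manipulation of `SchneiderFreeAdditiveX3PoitouTateReciprocityGeneralBase` (E-side value as a sum over
places `IdeleCohomology.inv_eq_sum_place`, the finite dictionary (P3), the archimedean dictionary
`HomDual.localInvInf_H2π_eq_neg_zmodToQmodZ_localTatePairingZMod_localReadout` fed by (P4)) turns it into door-c5 g18's hypothesis
`hE` of `poitouTate_selmerStructure_duality_of_reciprocitySum` — the sign-free reciprocity sum for THE idèle projections and THE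
canonical invariant maps (`reciprocitySum_holds`).  Consequences, by `SchneiderFreeAdditiveX3PoitouTateReciprocityCanonical`
(door-c4 g18): Milne I Thm. 4.10 (b) middle exactness for THE canonical family at every level and every admissible `S`
(`middleExact_canonical_holds`), `(LocalInvariants.canonical K n).SelmerComplement` (`selmerComplement_canonical_holds` — the input
`hcomp` of the `Ш²`-readout road to `poitouTate_sha_tateDual`, bsd-wall chl-p2), and the archimedean-inclusive variant
`poitouTate_selmerStructure_duality_real K` (`poitouTate_selmerStructure_duality_real_holds`).

HONEST FRAMING: unconditional theorems (no displayed hypothesis); everything rests on the tree's Tate duality for `(Γ_K, C̄_K)`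
(`IdeleClassBar`), the free-presentation road and the explicit-cocycle transport.  `poitouTate_sha_tateDual` is NOT proved here.

References: Milne, *Arithmetic Duality Theorems* (2006), Ch. I, Thm. 4.10 (b) (proof, p. 58), Lemma 4.13, Cor. 2.3, Thm. 2.6;
Cassels–Fröhlich, *ANT* (1967), Ch. VII §11.2 (bis); Howard, *Compos. Math.* 140 (2004), Thm. 2.1.11.
-/

noncomputable section

open Function NumberField IsDedekindDomain CategoryTheory CategoryTheory.Abelian groupCohomology
open scoped NumberField ContRepresentation

set_option linter.dupNamespace false
set_option autoImplicit false

namespace Summit.BirchSwinnertonDyer.BirchSwinnertonDyer.Theorems.SchneiderFreeAdditiveX3.PoitouTateReduction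

open Field
open Literature.NumberTheory.GaloisRepresentations Literature.NumberTheory.GaloisCohomology
open Literature.NumberTheory.GaloisRepresentations.DiscreteGaloisModule (mu TateDual tateDual localTatePairingZMod
  localTatePairingZMod_apply unramifiedSubgroup)
open Literature.Algebra.Homology Literature.Algebra.Homology.DiscreteRep Literature.Algebra.Homology.ExtPresentation
open Literature.NumberTheory.GaloisRepresentations.IdeleClassBar (classBarD classBarInv GalLayer)
open Literature.NumberTheory.GaloisRepresentations.FreePresentation
open Literature.NumberTheory.GaloisRepresentations.HomDual (IdeleProjection readout readoutInvariant localReadout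
  readout_eq_localReadout charZero_of_algebra equivariantMap restrictIntertwining isSES_restrict)
open Literature.NumberTheory.GaloisRepresentations.DGMBridge (LCarrier)
open Literature.NumberTheory.GaloisRepresentations.IdeleReadout (ideleProjection layerEmb)
open Literature.NumberTheory.Automorphic (IdeleClassGroup.ideleRep)
open Literature.AnabelianGeometry.AbsoluteAnabelian.Prop121vii (zmodToQmodZ brauerInvariantEquiv)

attribute [local instance] absoluteGaloisGroup_compactSpace

variable (K : Type) [Field K] [NumberField K]

/-- **THE SIGN-FREE E-SIDE RECIPROCITY SUM HOLDS** for every number field `K`: for every level `n`, every finite `n`-torsion `M`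
with a biduality `ι`, every `(f, ŷ, T₀)`, there are `x ∈ H¹(K, M)` and `Tx ⊇ T₀` with `x` unramified off `Tx` such that for every
`T' ⊇ Tx` the vanishing of the reciprocity sum over `T'` (archimedean terms through THE canonical invariant maps, finite terms through
the Brauer invariants of the transported classes) forces `classBarInv K (ŷ ∘ ∂(f ≫ g)) = 0` — door-c5 g18's `hE`, discharged by the
idèle package. [cite: MilneADT2006, Ch. I, Thm. 4.10 (b) (proof, p. 58), Lemma 4.13][cite: CasselsFrohlichANT1967, Ch. VII §11.2 (bis)] -/
theorem reciprocitySum_holds :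
    ∀ (n : ℕ) [NeZero n],
      ∀ ⦃M : Type⦄ [AddCommGroup M] [TopologicalSpace M] [DiscreteTopology M] [Finite M] [Finite (TateDual K M n)]
      (ρ₀ : DiscreteGaloisModule K M) (hM : ∀ m : M, n • m = 0)
      (ι : ρ₀.toContRepresentation →ⁱL ((ρ₀.tateDual n).tateDual n).toContRepresentation),
      (∀ (m : M) (f : TateDual K M n), ι m f = f m) →
      ∀ (f : (presentationComplex ρ₀).X₁ ⟶ (ideleClassLimitShortComplex K).X₂)
        (ŷ : Abelian.Ext (triv (Γ := absoluteGaloisGroup K) ℤ) (presentationComplex ρ₀).X₃ 1) (T₀ : Finset (Place K)),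
        ∃ (x : galoisCohomology ρ₀ 1) (Tx : Finset (Place K)), T₀ ⊆ Tx ∧
          (∀ v : HeightOneSpectrum (𝓞 K), (Sum.inr v : Place K) ∉ Tx →
            galoisCohomology.localization ρ₀ (Sum.inr v) 1 x ∈ unramifiedSubgroup (GaloisRep.toLocal v ρ₀) 1) ∧
          ∀ T' : Finset (Place K), Tx ⊆ T' →
            (∑ v ∈ T', Sum.elim
              (fun w : InfinitePlace K => zmodToQmodZ n
                (localTatePairingZMod (ρ₀.tateDual n) n (Sum.inl w) (LocalInvariants.canonical K n (Sum.inl w))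
                  (readout ρ₀ n hM (IdeleReadout.ideleProjection K (Sum.inl w)) f)
                  (galoisCohomology.localization ((ρ₀.tateDual n).tateDual n) (Sum.inl w) 1
                    (galoisCohomology.map ι 1 x))))
              (fun v : HeightOneSpectrum (𝓞 K) =>
                haveI := moduleFinite_presModule₁ ρ₀
                haveI : CharZero (v.adicCompletion K) := charZero_of_algebra (K := K) (v.adicCompletion K);
                - brauerInvariantEquiv (v.adicCompletion K)
                  (cohomologyMap (toTopRepHom ((presModule₁ ρ₀).restrictField (v.adicCompletion K))
                      (DiscreteGaloisModule.units (v.adicCompletion K))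
                      (equivariantMap ((presModule₁ ρ₀).restrictField (v.adicCompletion K))
                        (DiscreteGaloisModule.units (v.adicCompletion K))
                        (readoutInvariant (IdeleReadout.ideleProjection K (Sum.inr v)) (presentationComplex ρ₀).X₁ f))) 2
                    (galoisCohomology.res (presModule₁ ρ₀) (v.adicCompletion K) 2 ((pres_isSES ρ₀).δ₁ x))))
              v) = 0 →
            classBarInv K (ŷ.comp (boundary (presentationComplex_shortExact ρ₀) (classBarD K)
              (f ≫ (ideleClassLimitShortComplex K).g)) (rfl : 1 + 1 = 2)) = 0 := by
  intro n _ M _ _ _ _ _ ρ₀ hM ι hι f ŷ T₀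
  obtain ⟨E, b, x, Tx, hT₀, hinf, hur, hP1, hP2, hP3, hP4⟩ := idelePackage_holds K n ρ₀ hM ι hι f ŷ T₀
  refine ⟨x, Tx, hT₀, hur, fun T' hT' hsum => ?_⟩
  haveI := E.numberField
  haveI := E.isGalois
  haveI := E.finiteDimensional
  haveI := moduleFinite_presModule₁ ρ₀
  -- a biduality inverse `κ` for the given `ι`
  obtain ⟨ι', κ, hι', hκι', hικ⟩ := exists_bidual_intertwining (n := n) ρ₀ hM
  have hιι' : ∀ m : M, ι m = ι' m := fun m =>
    DiscreteGaloisModule.TateDual.ext fun g => by rw [hι, hι']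
  have hκι : ∀ m : M, κ (ι m) = m := fun m => by rw [hιι']; exact hκι' m
  have hκ : ∀ (Φ : TateDual K (TateDual K M n) n) (g : TateDual K M n), Φ g = g (κ Φ) := fun Φ g => by
    conv_lhs => rw [← hικ Φ]
    exact hι' (κ Φ) g
  -- the E-side value as one sum over `T'` (term-mode steps: no `rw` with coercion-headed patterns in this goal)
  refine hP1.trans ?_
  refine (IdeleCohomology.inv_eq_sum_place (E := E.1) (H2π _ b) T' (fun w => hT' (hinf w))
    (fun v hv => hP2 v fun h => hv (hT' h))).trans ?_
  -- termwise the E-side summand is minus the summand of the reciprocity sum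
  rw [← neg_eq_zero, ← Finset.sum_neg_distrib]
  refine Eq.trans (Finset.sum_congr rfl ?_) hsum
  rintro (w | v) -
  · -- infinite place: the archimedean dictionary (both sides `2`-torsion; transport only at real `w`)
    exact neg_eq_iff_eq_neg.mpr
      (HomDual.localInvInf_H2π_eq_neg_zmodToQmodZ_localTatePairingZMod_localReadout ρ₀ n hM w (layerEmb E) b ι κ hκι hκ _ x (hP4 w))
  · -- finite place: the finite dictionary
    exact neg_eq_iff_eq_neg.mpr ((hP3 v).trans (neg_neg _).symm)

/-- **Milne I Thm. 4.10 (b) middle exactness `Ker γ¹ ⊆ Im β¹` for THE canonical invariant maps HOLDS** at every level `n`, every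
admissible `S ⊇ {v ∣ ∞}` and every finite `n`-torsion `M`, for every number field `K`.
[cite: MilneADT2006, Ch. I, Thm. 4.10 (b) (proof, p. 58), Lemma 4.13, Thm. 1.8][cite: CasselsFrohlichANT1967, Ch. VII §11.2 (bis)] -/
theorem middleExact_canonical_holds :
    ∀ (n : ℕ) [NeZero n],
      ∀ ⦃M : Type⦄ [AddCommGroup M] [TopologicalSpace M] [DiscreteTopology M] [Finite M]
      (ρ : DiscreteGaloisModule K M), (∀ m : M, n • m = 0) →
      ∀ S : Finset (Place K), (∀ w : InfinitePlace K, (Sum.inl w : Place K) ∈ S) →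
        (∀ v : HeightOneSpectrum (𝓞 K), (Sum.inr v : Place K) ∉ S →
          ((n : ℕ) : 𝓞 K) ∉ v.asIdeal ∧ GaloisRep.IsUnramifiedAt v ρ) →
        ∀ t : Π v : Place K, galoisCohomology (ρ.toLocal v) 1,
          (∀ y : galoisCohomology (ρ.tateDual n) 1,
            (∀ v : HeightOneSpectrum (𝓞 K), (Sum.inr v : Place K) ∉ S →
              galoisCohomology.localization (ρ.tateDual n) (Sum.inr v) 1 y ∈
                unramifiedSubgroup (GaloisRep.toLocal v (ρ.tateDual n)) 1) →
            ∑ v ∈ S, localTatePairingZMod ρ n v (LocalInvariants.canonical K n v) (t v)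
              (galoisCohomology.localization (ρ.tateDual n) v 1 y) = 0) →
          ∃ x : galoisCohomology ρ 1,
            (∀ v : HeightOneSpectrum (𝓞 K), (Sum.inr v : Place K) ∉ S →
              galoisCohomology.localization ρ (Sum.inr v) 1 x ∈
                unramifiedSubgroup (GaloisRep.toLocal v ρ) 1) ∧
            ∀ v ∈ S, galoisCohomology.localization ρ v 1 x = t v :=
  middleExact_canonical_of_reciprocitySum (reciprocitySum_holds K)

/-- **`SelmerComplement` OF THE CANONICAL FAMILY HOLDS at every level**, for every number field — the input `hcomp` of the
`Ш²`-readout road to `poitouTate_sha_tateDual`.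
[cite: MilneADT2006, Ch. I, Thm. 4.10 (b)][cite: Howard2004HeegnerKolyvagin, Thm. 2.1.11 (arXiv:1202.6340 p. 6)] -/
theorem selmerComplement_canonical_holds (n : ℕ) [NeZero n] : (LocalInvariants.canonical K n).SelmerComplement :=
  selmerComplement_canonical_of_reciprocitySum (reciprocitySum_holds K) n

/-- **`poitouTate_selmerStructure_duality_real K` HOLDS for every number field `K`** (the archimedean-inclusive variant: one family
of local invariant maps — THE canonical one — with Milne I Cor. 2.3 at every finite place, Thm. 2.6 at the finite places,
Thm. 4.10 (b) for every admissible `S`, and Howard's Thm. 2.1.11 for Selmer structures with conditions at the real places too).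
[cite: MilneADT2006, Ch. I, Thm. 4.10 (b), Cor. 2.3, Thm. 2.6][cite: Howard2004HeegnerKolyvagin, Thm. 2.1.11 (arXiv:1202.6340 p. 6)] -/
theorem poitouTate_selmerStructure_duality_real_holds : poitouTate_selmerStructure_duality_real K :=
  poitouTate_selmerStructure_duality_real_of_reciprocitySum (reciprocitySum_holds K)

end Summit.BirchSwinnertonDyer.BirchSwinnertonDyer.Theorems.SchneiderFreeAdditiveX3.PoitouTateReduction

end
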